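import Summits.QuantumFields.YangMills.Theorems.BalabanLadderUVSeamRecTorusLaplaceSU2
import Summits.QuantumFields.YangMills.Theorems.LangevinControlUVOSLegsFromFemtoAndGapDefs
import Literature.MathematicalPhysics.QuantumLattice.RepLieAlgebraUnitary
import Mathlib.MeasureTheory.Measure.Tilted
import HarnessLib

/-!
# Crux `UVSeamRec` (stmt-QuantumFields-20043): the COLD-WALL BOX-AVERAGE thermal ceiling —
# `kerE^𝟙_{β,Λ}(S_Λ) ≤ #P_Λ (34 + 6 log β)/β` for every finite link set `Λ`, uniformly in its size

Helper file (`--supports stmt-QuantumFields-20043`) of the LEAD seat `ym-spine-20043-p1` (gen 11).  Sizing of record: tempered-d1 g5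
`MEMO-D1-g5-coldwall-ceiling.md` §Tier 3(b) («the box-AVERAGE ceiling uniformly in R … useful as the honest interim letter if the line wants a cold-wall
reference datum now»); the POINTWISE cold-wall-centre ceiling (Tier 3) is not attempted (director-ym R395).  Line «coldwall_pure» (ym-idea-10) posits
the cold-wall kernel `kerE^{𝟙}_{β,R}` as the reference of its (DR)/(CW) stubs; this file gives its first hypothesis-free thermal ceiling.

* §1 **`mul_gibbsMean_le_neg_log`** — Gibbs–Jensen on an arbitrary probability space: for bounded measurable `S` and `β ≥ 0`,
  `β · (∫ S e^{−βS} dπ / ∫ e^{−βS} dπ) ≤ −log ∫ e^{−βS} dπ` (Jensen for `exp` under the tilted measure `π.tilted(−βS)`, Mathlib `integral_exp_tilted`);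
* §2 `norm_map_plaquetteHolonomyZd_sub_one_le`, `wilsonBoundaryAction_le_of_forall_norm_le` — on the link ball `{‖ρ(U_e) − 1‖_F ≤ r ∀ e}` of `ℤ⁴`
  the boundary Wilson action of `Λ` is `≤ 8r² · #P_Λ` (`P_Λ` = plaquettes touching `Λ`); `card_le_four_mul_card_plaquettesTouching` (`#Λ ≤ 4 #P_Λ`);
* §3 **`integral_wilsonBoundaryAction_ymSpecification_one_le`** — for every compact `G`, continuous unitary `ρ`, finite `Λ ⊂` links of `ℤ⁴`, `β > 0`,
  `r > 0`: under the Yang–Mills kernel of `Λ` with the IDENTITY exterior, `∫ S_Λ dγ_Λ(·|𝟙) ≤ 8r² #P_Λ − #Λ · log φ_ρ(r)/β` (`φ_ρ(r) = Haar{‖ρ g − 1‖_F ≤ r}`: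
  the fibre integral `Z_Λ(β; 𝟙) ≥ e^{−8βr²#P_Λ} φ_ρ(r)^{#Λ}` by restriction to the link ball, all exterior links being `1`);
* §4 **`kerE_one_wilsonBoundaryAction_le`** — `SU(2)`, crux letters: for every cube `(c, b)` and `β ≥ 1`,
  `kerE^{𝟙}_{β,(c,b)}(S_Λ) ≤ (8 #P_Λ + #Λ((3/2) log β + 13/2))/β ≤ #P_Λ · (34 + 6 log β)/β` (`r = β^{−1/2}`, sharp small ball `r³/600` of
  `…TorusLaplaceSU2`): the AVERAGE plaquette deficit of a cold-wall cube is `O(log β/β)` UNIFORMLY IN THE CUBE — the cold-wall twin of Tier 1.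
  Removing the log here needs gauge fixing inside the cube (only the `(b−2)⁴` deep sites carry a gauge symmetry of the kernel); not done.

HONEST FRAMING: an elementary one-sided Laplace bound for ONE Dirichlet cube kernel at the identity exterior (box average, not the centre plaquette);
nothing of E0′, NT or the gap; not Clay.
-/

open MeasureTheory Finset
open scoped ENNReal Matrix Matrix.Norms.Frobenius
open Literature.MathematicalPhysics.QuantumFieldTheory (haarProbability LatticeRep norm_mul_sub_one_le_of_mem_unitaryGroup
  sub_re_trace_eq_half_norm_sub_one_sq)
open Literature.MathematicalPhysics.QuantumLattice
open Literature.Probability.LatticeModels (glueWith glueWith_apply_mem glueWith_apply_not_mem)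
open Summit.QuantumFields.YangMills.Cruxes.OSLegsFromFemtoAndGap.DlrCollarTransfer

noncomputable section

namespace Summit.QuantumFields.YangMills.Cruxes.UVSeamRec.ClassicalResponse.ThermalFloor

/-! ### §1 Gibbs–Jensen on a probability space -/

/-- **Gibbs–Jensen.**  On a probability space, for a bounded measurable `S` and `β ≥ 0`:
`β · ⟨S⟩_β ≤ −log Z(β)`, where `Z(β) = ∫ e^{−βS} dπ` and `⟨S⟩_β = ∫ S e^{−βS} dπ / Z(β)` — Jensen's inequality for `exp` under the tilted measure
`π.tilted(−βS)`: `1/Z(β) = ∫ e^{βS} d(tilted) ≥ exp(β⟨S⟩_β)`. [cite: FriedliVelenik2017, Lemma 3.5 (p. 94), App. B.8.1] -/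
theorem mul_gibbsMean_le_neg_log {Ω : Type*} [MeasurableSpace Ω] (π : Measure Ω) [IsProbabilityMeasure π] {S : Ω → ℝ}
    (hS : Measurable S) {C : ℝ} (hSb : ∀ ω, |S ω| ≤ C) (β : ℝ) :
    β * ((∫ ω, S ω * Real.exp (-β * S ω) ∂π) / ∫ ω, Real.exp (-β * S ω) ∂π) ≤ -Real.log (∫ ω, Real.exp (-β * S ω) ∂π) := by
  set f : Ω → ℝ := fun ω => -β * S ω with hf
  have hfm : Measurable f := hS.const_mul _
  have hfb : ∀ ω, |f ω| ≤ |β| * C := fun ω => by rw [hf]; simp only [neg_mul, abs_neg, abs_mul]; gcongr; exact hSb ω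
  have hexp_int : Integrable (fun ω => Real.exp (f ω)) π :=
    Integrable.of_bound (Real.measurable_exp.comp hfm).aestronglyMeasurable (Real.exp (|β| * C))
      (ae_of_all _ fun ω => by rw [Real.norm_eq_abs, Real.abs_exp]; exact Real.exp_le_exp.2 ((le_abs_self _).trans (hfb ω)))
  set Z : ℝ := ∫ ω, Real.exp (f ω) ∂π with hZ
  have hZpos : 0 < Z := by
    rw [hZ]; exact integral_exp_pos hexp_int
  set ν : Measure Ω := π.tilted f with hν
  haveI : IsProbabilityMeasure ν := isProbabilityMeasure_tilted hexp_int
  -- `∫ (βS) dν` and `∫ exp(βS) dν`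
  have hg_int : Integrable (fun ω => β * S ω) ν :=
    Integrable.of_bound (hS.const_mul β).aestronglyMeasurable (|β| * C)
      (ae_of_all _ fun ω => by rw [Real.norm_eq_abs, abs_mul]; gcongr; exact hSb ω)
  have heg_int : Integrable (fun ω => Real.exp (β * S ω)) ν :=
    Integrable.of_bound (Real.measurable_exp.comp (hS.const_mul β)).aestronglyMeasurable (Real.exp (|β| * C))
      (ae_of_all _ fun ω => by
        rw [Real.norm_eq_abs, Real.abs_exp]
        refine Real.exp_le_exp.2 ((le_abs_self _).trans ?_)
        rw [abs_mul]; gcongr; exact hSb ω)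
  have hJ := (convexOn_exp.map_integral_le Real.continuous_exp.continuousOn isClosed_univ
    (ae_of_all _ fun _ => Set.mem_univ _) hg_int heg_int)
  -- `∫ exp(βS) dν = 1/Z`
  have h1 : ∫ ω, Real.exp (β * S ω) ∂ν = 1 / Z := by
    have h := integral_exp_tilted (μ := π) f (fun ω => β * S ω)
    rw [hν, h]
    have : (f + fun ω => β * S ω) = fun _ => (0 : ℝ) := by funext ω; simp [hf]
    rw [this, ← hZ]
    simp
  -- `∫ βS dν = β ⟨S⟩`
  have h2 : ∫ ω, β * S ω ∂ν = β * ((∫ ω, S ω * Real.exp (-β * S ω) ∂π) / Z) := by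
    rw [hν, integral_tilted]
    simp_rw [smul_eq_mul]
    have : ∀ ω, Real.exp (f ω) / (∫ x, Real.exp (f x) ∂π) * (β * S ω) =
        (β / ∫ x, Real.exp (f x) ∂π) * (S ω * Real.exp (-β * S ω)) := by
      intro ω
      have he : Real.exp (f ω) = Real.exp (-β * S ω) := by rw [hf]
      rw [he]; ring
    simp_rw [this]
    rw [integral_const_mul, ← hZ]
    ring
  rw [h1, h2] at hJ
  have h3 : Real.exp (β * ((∫ ω, S ω * Real.exp (-β * S ω) ∂π) / Z)) ≤ 1 / Z := hJ
  have h4 := Real.log_le_log (Real.exp_pos _) h3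
  rw [Real.log_exp, one_div, Real.log_inv] at h4
  exact h4

/-! ### §2 The link ball on `ℤ⁴` -/

section Ball

variable {N : ℕ} {G : Type*} [Group G] (ρ : G →* Matrix (Fin N) (Fin N) ℂ)

/-- **A `ℤ⁴` plaquette is close to `1` when its four links are**: on the link ball `{‖ρ(U_e) − 1‖_F ≤ r ∀ e}`,
`‖ρ(U_p) − 1‖_F ≤ 4r` for every plaquette `p` of `ℤ^d`. [cite: HornJohnson2013, Thm 2.2.2] -/
theorem norm_map_plaquetteHolonomyZd_sub_one_le {d : ℕ} (hρU : ∀ g, ρ g ∈ Matrix.unitaryGroup (Fin N) ℂ)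
    {r : ℝ} {U : LGConfig d G} (hU : ∀ e, ‖ρ (U e) - 1‖ ≤ r) (x : Fin d → ℤ) (i j : Fin d) :
    ‖ρ (plaquetteHolonomyZd U x i j) - 1‖ ≤ 4 * r := by
  have hmul : ∀ a b : G, ‖ρ (a * b) - 1‖ ≤ ‖ρ a - 1‖ + ‖ρ b - 1‖ := fun a b => by
    rw [map_mul]; exact norm_mul_sub_one_le_of_mem_unitaryGroup (hρU a)
  -- `‖ρ(g⁻¹) − 1‖_F = ‖ρ(g) − 1‖_F` (right multiplication by the unitary `ρ g`; tree `DoublingOfRV.norm_rho_inv_sub_one`, inlined for import hygiene)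
  have hinv : ∀ g : G, ‖ρ g⁻¹ - 1‖ = ‖ρ g - 1‖ := fun g => by
    have h : (ρ g⁻¹ - 1) * ρ g = 1 - ρ g := by
      rw [Matrix.sub_mul, Matrix.one_mul, ← map_mul, inv_mul_cancel, map_one]
    calc ‖ρ g⁻¹ - 1‖ = ‖(ρ g⁻¹ - 1) * ρ g‖ := (Matrix.frobenius_norm_mul_unitaryGroup (ρ g⁻¹ - 1) ⟨ρ g, hρU g⟩).symm
      _ = ‖1 - ρ g‖ := by rw [h]
      _ = ‖ρ g - 1‖ := norm_sub_rev _ _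
  unfold plaquetteHolonomyZd
  have h1 := hU (x, i)
  have h2 := hU (x + Pi.single i 1, j)
  have h3 : ‖ρ (U (x + Pi.single j 1, i))⁻¹ - 1‖ ≤ r := by rw [hinv]; exact hU _
  have h4 : ‖ρ (U (x, j))⁻¹ - 1‖ ≤ r := by rw [hinv]; exact hU _
  calc ‖ρ (U (x, i) * U (x + Pi.single i 1, j) * (U (x + Pi.single j 1, i))⁻¹ * (U (x, j))⁻¹) - 1‖
      ≤ ‖ρ (U (x, i) * U (x + Pi.single i 1, j) * (U (x + Pi.single j 1, i))⁻¹) - 1‖ + ‖ρ (U (x, j))⁻¹ - 1‖ := hmul _ _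
    _ ≤ ‖ρ (U (x, i) * U (x + Pi.single i 1, j)) - 1‖ + ‖ρ (U (x + Pi.single j 1, i))⁻¹ - 1‖ + ‖ρ (U (x, j))⁻¹ - 1‖ := by
        gcongr; exact hmul _ _
    _ ≤ ‖ρ (U (x, i)) - 1‖ + ‖ρ (U (x + Pi.single i 1, j)) - 1‖ + ‖ρ (U (x + Pi.single j 1, i))⁻¹ - 1‖ + ‖ρ (U (x, j))⁻¹ - 1‖ := by
        gcongr; exact hmul _ _
    _ ≤ r + r + r + r := by gcongr
    _ = 4 * r := by ring

/-- **On the link ball the boundary Wilson action of `Λ` is at most `8r² · #P_Λ`** (`N − Re tr ρ(U_p) = ‖ρ(U_p) − 1‖_F²/2 ≤ 8r²` for every plaquette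
touching `Λ`). [cite: HornJohnson2013, Thm 2.2.2] -/
theorem wilsonBoundaryAction_le_of_forall_norm_le (hρU : ∀ g, ρ g ∈ Matrix.unitaryGroup (Fin N) ℂ) (Λ : Finset (ZdEdge 4))
    {r : ℝ} {U : LGConfig 4 G} (hU : ∀ e, ‖ρ (U e) - 1‖ ≤ r) :
    wilsonBoundaryAction ρ Λ U ≤ 8 * r ^ 2 * (plaquettesTouching Λ).card := by
  unfold wilsonBoundaryAction
  have hr : 0 ≤ r := (norm_nonneg _).trans (hU ((0 : Fin 4 → ℤ), (0 : Fin 4)))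
  calc ∑ p ∈ plaquettesTouching Λ, ((N : ℝ) - plaquetteObs ρ p.1 p.2.1.1 p.2.1.2 U)
      ≤ ∑ _p ∈ plaquettesTouching Λ, 8 * r ^ 2 := by
        refine Finset.sum_le_sum fun p _ => ?_
        unfold plaquetteObs
        rw [sub_re_trace_eq_half_norm_sub_one_sq (hρU _)]
        have h4 := norm_map_plaquetteHolonomyZd_sub_one_le ρ hρU hU p.1 p.2.1.1 p.2.1.2
        have h0 : 0 ≤ ‖ρ (plaquetteHolonomyZd U p.1 p.2.1.1 p.2.1.2) - 1‖ := norm_nonneg _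
        nlinarith
    _ = 8 * r ^ 2 * (plaquettesTouching Λ).card := by rw [Finset.sum_const, nsmul_eq_mul, mul_comm]

omit [Group G] in
/-- `#Λ ≤ 4 · #P_Λ`: every link of `Λ` lies on a plaquette touching `Λ`, and a plaquette has four edges. [folklore] -/
theorem card_le_four_mul_card_plaquettesTouching (Λ : Finset (ZdEdge 4)) : Λ.card ≤ 4 * (plaquettesTouching Λ).card := by
  classical
  have hsub : Λ ⊆ (plaquettesTouching Λ).biUnion plaquetteEdges := by
    intro e he
    rw [Finset.mem_biUnion]
    -- the plaquette based at `e.1` in the plane spanned by `e.2` and another direction contains `e`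
    obtain ⟨j, hj⟩ : ∃ j : Fin 4, j ≠ e.2 := ⟨e.2 + 1, by
      intro h; have := congrArg (fun z : Fin 4 => z - e.2) h; simp at this⟩
    rcases lt_or_gt_of_ne hj with hlt | hgt
    · refine ⟨(e.1, ⟨(j, e.2), hlt⟩), ?_, ?_⟩
      · rw [mem_plaquettesTouching_iff]
        exact ⟨e, Finset.mem_inter.2 ⟨by simp [plaquetteEdges], he⟩⟩
      · simp [plaquetteEdges]
    · refine ⟨(e.1, ⟨(e.2, j), hgt⟩), ?_, ?_⟩
      · rw [mem_plaquettesTouching_iff]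
        exact ⟨e, Finset.mem_inter.2 ⟨by simp [plaquetteEdges], he⟩⟩
      · simp [plaquetteEdges]
  calc Λ.card ≤ ((plaquettesTouching Λ).biUnion plaquetteEdges).card := Finset.card_le_card hsub
    _ ≤ ∑ p ∈ plaquettesTouching Λ, (plaquetteEdges p).card := Finset.card_biUnion_le
    _ ≤ ∑ _p ∈ plaquettesTouching Λ, 4 := Finset.sum_le_sum fun p _ => by
        unfold plaquetteEdges
        exact (Finset.card_insert_le _ _).trans (Nat.succ_le_succ ((Finset.card_insert_le _ _).trans
          (Nat.succ_le_succ ((Finset.card_insert_le _ _).trans (by simp)))))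
    _ = 4 * (plaquettesTouching Λ).card := by rw [Finset.sum_const, smul_eq_mul, mul_comm]

end Ball

/-! ### §3 The cold-wall box ceiling, general compact group -/

section General

variable {N : ℕ} {G : Type*} [Group G] [TopologicalSpace G] [IsTopologicalGroup G] [CompactSpace G] [MeasurableSpace G]
  [BorelSpace G] [SecondCountableTopology G] (ρ : G →* Matrix (Fin N) (Fin N) ℂ)

/-- **THE COLD-WALL BOX CEILING (general compact gauge group).**  For a continuous unitary representation `ρ`, a finite link set `Λ` of `ℤ⁴`,
`β > 0` and `r > 0`: under the Yang–Mills kernel of `Λ` with the IDENTITY exterior,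
`∫ S_Λ dγ_Λ(·|𝟙) ≤ 8 r² #P_Λ − #Λ · log φ_ρ(r) / β`, `φ_ρ(r) = Haar{g : ‖ρ g − 1‖_F ≤ r}` — Gibbs–Jensen on the fibre `G^Λ` plus the
restriction of the fibre integral to the link ball (where, all exterior links being `1`, every plaquette touching `Λ` costs `≤ 8r²`).
[cite: FriedliVelenik2017, Lemma 3.5 (p. 94), App. B.8.1] -/
theorem integral_wilsonBoundaryAction_ymSpecification_one_le (hρ : Continuous ρ) (hρU : ∀ g, ρ g ∈ Matrix.unitaryGroup (Fin N) ℂ)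
    (Λ : Finset (ZdEdge 4)) {β : ℝ} (hβ : 0 < β) {r : ℝ} (hr : 0 < r) :
    ∫ U, wilsonBoundaryAction ρ Λ U ∂(ymSpecification (d := 4) ρ β Λ (fun _ => 1)) ≤
      8 * r ^ 2 * (plaquettesTouching Λ).card - Λ.card * Real.log ((haarProbability G).real {g : G | ‖ρ g - 1‖ ≤ r}) / β := by
  classical
  set π : Measure (↥Λ → G) := Measure.pi fun _ : ↥Λ => haarProbability G with hπ
  haveI hprob : IsProbabilityMeasure (haarProbability G) :=
    ⟨by simpa [haarProbability] using Measure.haarMeasure_self (G := G) (K₀ := ⊤)⟩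
  haveI : IsProbabilityMeasure π := by rw [hπ]; infer_instance
  set η₀ : LGConfig 4 G := fun _ => 1 with hη₀
  set S : (↥Λ → G) → ℝ := fun ζ => wilsonBoundaryAction ρ Λ (glueWith Λ ζ η₀) with hSdef
  have hgl : Continuous fun ζ : ↥Λ → G => glueWith Λ ζ η₀ :=
    (continuous_glueWith_prod Λ).comp (Continuous.prodMk continuous_const continuous_id)
  have hSc : Continuous S := (continuous_wilsonBoundaryAction ρ hρ Λ).comp hgl
  -- `S` is bounded on the compact fibre
  obtain ⟨C, hC⟩ : ∃ C, ∀ ζ, |S ζ| ≤ C := by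
    obtain ⟨ζ₀, -, hζ₀⟩ := isCompact_univ.exists_isMaxOn Set.univ_nonempty (continuous_abs.comp hSc).continuousOn
    exact ⟨|S ζ₀|, fun ζ => hζ₀ (Set.mem_univ ζ)⟩
  -- the kernel mean is the Gibbs mean on the fibre
  rw [integral_ymSpecification ρ hρ β Λ (continuous_wilsonBoundaryAction ρ hρ Λ).measurable η₀]
  change (∫ ζ, S ζ * Real.exp (-β * S ζ) ∂π) / (∫ ζ, Real.exp (-β * S ζ) ∂π) ≤ _
  have hJ := mul_gibbsMean_le_neg_log π hSc.measurable hC β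
  -- the link ball in the fibre and the lower bound on the fibre integral
  set Ball : Set G := {g : G | ‖ρ g - 1‖ ≤ r} with hBall
  have hBallm : MeasurableSet Ball :=
    (isClosed_le ((continuous_norm.comp (hρ.sub continuous_const))) continuous_const).measurableSet
  set A : Set (↥Λ → G) := Set.pi Set.univ fun _ : ↥Λ => Ball with hA
  have hAm : MeasurableSet A := MeasurableSet.univ_pi fun _ => hBallm
  set ε : ℝ := 8 * r ^ 2 * (plaquettesTouching Λ).card with hε
  have hSA : ∀ ζ ∈ A, S ζ ≤ ε := by
    intro ζ hζ
    have hU : ∀ e, ‖ρ (glueWith Λ ζ η₀ e) - 1‖ ≤ r := by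
      intro e
      by_cases he : e ∈ Λ
      · rw [glueWith_apply_mem _ _ _ he]; exact hζ ⟨e, he⟩ (Set.mem_univ _)
      · rw [glueWith_apply_not_mem _ _ _ he, hη₀]
        simp only [map_one, sub_self, norm_zero]; exact hr.le
    exact wilsonBoundaryAction_le_of_forall_norm_le ρ hρU Λ hU
  set φ : ℝ := (haarProbability G).real Ball with hφdef
  have h1Ball : (1 : G) ∈ Ball := by
    show ‖ρ 1 - 1‖ ≤ r; rw [map_one, sub_self, norm_zero]; exact hr.le
  have hφpos : 0 < φ := by
    haveI : (haarProbability G).IsOpenPosMeasure := by unfold haarProbability; infer_instance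
    have hopen : IsOpen {g : G | ‖ρ g - 1‖ < r} := isOpen_lt (continuous_norm.comp (hρ.sub continuous_const)) continuous_const
    have hne : ({g : G | ‖ρ g - 1‖ < r}).Nonempty := ⟨1, by simpa using hr⟩
    have hpos := hopen.measure_pos (haarProbability G) hne
    have hsub : {g : G | ‖ρ g - 1‖ < r} ⊆ Ball := fun g (hg : _ < r) => le_of_lt hg
    exact ENNReal.toReal_pos (ne_of_gt (hpos.trans_le (measure_mono hsub))) (measure_ne_top _ _)
  have hπA : π.real A = φ ^ Λ.card := by
    rw [measureReal_def, hA, hπ, Measure.pi_pi, Finset.prod_const, Finset.card_univ, Fintype.card_coe, ENNReal.toReal_pow,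
      ← measureReal_def]
  have hZlow : Real.exp (-β * ε) * φ ^ Λ.card ≤ ∫ ζ, Real.exp (-β * S ζ) ∂π := by
    have hind : ∫ ζ, A.indicator (fun _ => Real.exp (-β * ε)) ζ ∂π = Real.exp (-β * ε) * π.real A := by
      rw [integral_indicator_const _ hAm, smul_eq_mul, mul_comm]
    rw [← hπA, ← hind]
    have hint : Integrable (fun ζ => Real.exp (-β * S ζ)) π :=
      Integrable.of_bound (Real.measurable_exp.comp (hSc.measurable.const_mul _)).aestronglyMeasurable (Real.exp (|β| * C))
        (ae_of_all _ fun ζ => by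
          rw [Real.norm_eq_abs, Real.abs_exp]
          refine Real.exp_le_exp.2 ?_
          have h1 : |(-β) * S ζ| ≤ |β| * C := by rw [abs_mul, abs_neg]; gcongr; exact hC ζ
          exact (le_abs_self _).trans h1)
    refine integral_mono ((integrable_const _).indicator hAm) hint fun ζ => ?_
    by_cases hζ : ζ ∈ A
    · rw [Set.indicator_of_mem hζ]
      refine Real.exp_le_exp.2 ?_
      have := hSA ζ hζ
      nlinarith
    · rw [Set.indicator_of_notMem hζ]
      exact (Real.exp_pos _).le
  -- logarithms
  have hZpos : 0 < ∫ ζ, Real.exp (-β * S ζ) ∂π := lt_of_lt_of_le (mul_pos (Real.exp_pos _) (pow_pos hφpos _)) hZlow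
  have hlog : -Real.log (∫ ζ, Real.exp (-β * S ζ) ∂π) ≤ β * ε - Λ.card * Real.log φ := by
    have h := Real.log_le_log (mul_pos (Real.exp_pos _) (pow_pos hφpos _)) hZlow
    rw [Real.log_mul (Real.exp_pos _).ne' (pow_pos hφpos _).ne', Real.log_exp, Real.log_pow] at h
    linarith
  -- conclude
  have hkey : β * ((∫ ζ, S ζ * Real.exp (-β * S ζ) ∂π) / ∫ ζ, Real.exp (-β * S ζ) ∂π) ≤ β * (ε - Λ.card * Real.log φ / β) := by
    rw [mul_sub, mul_div_cancel₀ _ hβ.ne']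
    exact hJ.trans hlog
  exact le_of_mul_le_mul_left hkey hβ

end General

/-! ### §4 The `SU(2)` cold-wall cube, crux letters -/

section SU2

/-- **THE COLD-WALL BOX CEILING for `SU(2)` (crux letters).**  For the defining representation of `SU(2)` (tree units `β = β_W/2`), every cube `(c, b)` of
`ℤ⁴` (links `Λ = cubeEdges c b`, identity exterior) and every `β ≥ 1`:
`kerE^{𝟙}_{β,(c,b)}(S_Λ) ≤ (8 #P_Λ + #Λ·((3/2) log β + 13/2))/β` (`r = β^{−1/2}` and the sharp small ball `φ(r) ≥ r³/600`). [folklore] -/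
theorem kerE_one_wilsonBoundaryAction_le (c : Fin 4 → ℤ) (b : ℕ) {β : ℝ} (hβ : 1 ≤ β) :
    kerE (Matrix.specialUnitaryGroup (Fin 2) ℂ) (fundamentalLatticeRep 2) β c b (fun _ => 1)
        (wilsonBoundaryAction (fundamentalRep (Fin 2)) (cubeEdges c b)) ≤
      (8 * (plaquettesTouching (cubeEdges c b)).card + (cubeEdges c b).card * (3 / 2 * Real.log β + 13 / 2)) / β := by
  haveI : SecondCountableTopology (Matrix.specialUnitaryGroup (Fin 2) ℂ) := secondCountableTopology_su2
  have hβ0 : 0 < β := by linarith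
  set r : ℝ := Real.sqrt (1 / β) with hr
  have hr0 : 0 < r := Real.sqrt_pos.2 (by positivity)
  have hr2 : r ^ 2 = 1 / β := by rw [hr, Real.sq_sqrt (by positivity)]
  have hr1 : r ≤ 1 := by rw [hr, Real.sqrt_le_left zero_le_one, one_pow, div_le_one hβ0]; exact hβ
  have hφ := haarProbability_real_frobeniusBall_ge_su2_sharp hr0 hr1
  have h := integral_wilsonBoundaryAction_ymSpecification_one_le (fundamentalRep (Fin 2)) (continuous_fundamentalRep (Fin 2))
    fundamentalRep_mem_unitaryGroup (cubeEdges c b) hβ0 hr0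
  unfold kerE
  refine h.trans ?_
  -- `−log φ(r) ≤ (3/2) log β + 13/2`
  have hφpos : 0 < (haarProbability (Matrix.specialUnitaryGroup (Fin 2) ℂ)).real
      {g : Matrix.specialUnitaryGroup (Fin 2) ℂ | ‖fundamentalRep (Fin 2) g - 1‖ ≤ r} := lt_of_lt_of_le (by positivity) hφ
  have hlogφ : -Real.log ((haarProbability (Matrix.specialUnitaryGroup (Fin 2) ℂ)).real
      {g : Matrix.specialUnitaryGroup (Fin 2) ℂ | ‖fundamentalRep (Fin 2) g - 1‖ ≤ r}) ≤ 3 / 2 * Real.log β + 13 / 2 := by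
    have h1 := Real.log_le_log (by positivity) hφ
    rw [Real.log_div (by positivity) (by norm_num), Real.log_pow] at h1
    have hlogr : Real.log r = -(Real.log β) / 2 := by
      rw [hr, Real.log_sqrt (by positivity), one_div, Real.log_inv]
    rw [hlogr] at h1
    have h600 : Real.log 600 ≤ 13 / 2 := by
      rw [Real.log_le_iff_le_exp (by norm_num)]
      have he : (2.71828 : ℝ) < Real.exp 1 := lt_trans (by norm_num) Real.exp_one_gt_d9
      have h6 : Real.exp (13 / 2) = Real.exp 1 ^ 6 * Real.exp (1 / 2) := by
        rw [← Real.exp_nat_mul, ← Real.exp_add]; norm_num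
      have h25 : (1 : ℝ) + 1 / 2 ≤ Real.exp (1 / 2) := by
        have := Real.add_one_le_exp (1 / 2 : ℝ); linarith
      have hp : (2.71828 : ℝ) ^ 6 < Real.exp 1 ^ 6 := by gcongr
      have h403 : (403 : ℝ) < Real.exp 1 ^ 6 := lt_trans (by norm_num) hp
      rw [h6]
      nlinarith [Real.exp_pos (1 / 2 : ℝ), h403, h25]
    linarith
  set P : ℝ := ((plaquettesTouching (cubeEdges c b)).card : ℝ) with hPdef
  set L : ℝ := ((cubeEdges c b).card : ℝ) with hLdef
  set φ : ℝ := (haarProbability (Matrix.specialUnitaryGroup (Fin 2) ℂ)).real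
      {g : Matrix.specialUnitaryGroup (Fin 2) ℂ | ‖fundamentalRep (Fin 2) g - 1‖ ≤ r} with hφdef
  have hL : 0 ≤ L := Nat.cast_nonneg _
  rw [hr2]
  have e1 : 8 * (1 / β) * P - L * Real.log φ / β = (8 * P - L * Real.log φ) / β := by ring
  rw [e1]
  exact div_le_div_of_nonneg_right (by nlinarith [mul_le_mul_of_nonneg_left hlogφ hL]) hβ0.le

/-- **Box-average form**: for every cube `(c, b)` and `β ≥ 1`, `kerE^{𝟙}_{β,(c,b)}(S_Λ) ≤ #P_Λ · (34 + 6 log β)/β` (`#Λ ≤ 4 #P_Λ`): the AVERAGE plaquette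
deficit `2 − Re tr U_p` over the plaquettes touching a cold-wall cube is at most `(34 + 6 log β)/β`, UNIFORMLY IN THE CUBE. [folklore] -/
theorem kerE_one_wilsonBoundaryAction_le_card_mul (c : Fin 4 → ℤ) (b : ℕ) {β : ℝ} (hβ : 1 ≤ β) :
    kerE (Matrix.specialUnitaryGroup (Fin 2) ℂ) (fundamentalLatticeRep 2) β c b (fun _ => 1)
        (wilsonBoundaryAction (fundamentalRep (Fin 2)) (cubeEdges c b)) ≤
      (plaquettesTouching (cubeEdges c b)).card * ((34 + 6 * Real.log β) / β) := by
  have h := kerE_one_wilsonBoundaryAction_le c b hβ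
  have hβ0 : 0 < β := by linarith
  have hlog : 0 ≤ Real.log β := Real.log_nonneg hβ
  have hcard : ((cubeEdges c b).card : ℝ) ≤ 4 * (plaquettesTouching (cubeEdges c b)).card := by
    exact_mod_cast card_le_four_mul_card_plaquettesTouching (cubeEdges c b)
  refine h.trans ?_
  rw [mul_div, div_le_div_iff_of_pos_right hβ0]
  have hP : (0 : ℝ) ≤ (plaquettesTouching (cubeEdges c b)).card := Nat.cast_nonneg _
  nlinarith [mul_le_mul_of_nonneg_right hcard (by positivity : (0 : ℝ) ≤ 3 / 2 * Real.log β + 13 / 2)]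

end SU2


end Summit.QuantumFields.YangMills.Cruxes.UVSeamRec.ClassicalResponse.ThermalFloor

end
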